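import Literature.AlgebraicGeometry.AbelianSchemes.ModuleSliceOfBaseChange
import Literature.AlgebraicGeometry.AbelianSchemes.RigidifiedLineBundleSliceHomogeneous
import Literature.AlgebraicGeometry.AbelianSchemes.RigidifiedLineBundleLimitDescentStage
import Literature.AlgebraicGeometry.Morphisms.GeometricPointsLiftSurjective
import HarnessLib

/-!
# Clause (a) of a dual pair — «fibrewise in `Pic⁰`» — descends along a surjection of parameter schemes

Layer `Literature/AlgebraicGeometry/AbelianSchemes`, namespace
`Literature.AlgebraicGeometry.AbelianSchemes.AbelianSchemeOver`.  THEOREMS ONLY; no definition, no named fact, no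
instance, no notation, no `sorry`.

Setting ([MumfordAV1970] §8, §13; [MilneAV2008] I §8): an abelian scheme `A/S`, two parameter schemes `B′/S`, `B/S`
(abelian schemes, as in ★ `AbelianSchemeOver.DualPair`), an `S`-morphism `q : B′ ⟶ B` and a module `P` on
`A ×_S B`.  Clause (a) of ★ `DualPair` for `P` («for every GEOMETRIC point `b` of `B`, `P|_{A_s × {b}}` lies in
`Pic⁰(A_s)`, i.e. is translation invariant», [MumfordAV1970, §8 (iv) ⇔ (i)]) is read through the fibre slices
★ `AbelianSchemeOver.fibreSlice`.  If `q` is SURJECTIVE and locally of finite type, every geometric point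
`b : Spec Ω → B` LIFTS to a geometric point `t : Spec Ω → B′` with the SAME algebraically closed `Ω`
(★ `Morphisms.exists_comp_eq_of_surjective`: a closed point of the non-empty Jacobson scheme `B′ ×_B Spec Ω`, read
through the Nullstellensatz), and the slice of `P` at `b = t ≫ q` is the slice of `(1_A × q)^* P` at `t` up to the
transport `A_{t ≫ π′} = A_{(t ≫ q) ≫ π}` of fibres along the (propositional) equality of base points
(★ `fibreCongrIso`).  Hence:

* §1 `fibreCongrIso_hom_toSchemeHom_snd` (bookkeeping twin of ★ `fibreCongrIso_hom_toSchemeHom_fst`) and the slice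
  square `toSchemeHom_fibreCongrIso_hom_comp_fibreSlice :
  (fibreCongrIso _).hom ≫ fibreSlice B (t ≫ q) = fibreSlice B′ t ≫ (A.X ◁ q).left`;
* §2 `isHomogeneous_fibreSlice_whiskerLeft_iff` — the slice of `(1_A × q)^* P` at `t` is homogeneous iff the slice
  of `P` at `t ≫ q` is; **`forall_isHomogeneous_fibreSlice_of_surjective`** — if `(1_A × q)^* P ≅ N` and `N`
  satisfies clause (a) over `B′`, then `P` satisfies clause (a) over `B` (for `q` surjective, locally of finite type);
* §3 the bridge `RigidifiedLineBundle.isHomogeneous_fibreSlice_iff` between the slice form of clause (a) for the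
  module `ℒ.L` of a rigidified line bundle `ℒ` on `A_{B′} = A ×_S B′` and ★ `RigidifiedLineBundle.FibrewisePicZero`
  (the bookkeeping of ★ `DualPair.selfBundle_fibrewisePicZero`, both ways), and the export
  **`forall_isHomogeneous_fibreSlice_of_rigidified_of_surjective`**: if `(1_A × q)^* P ≅ ℒ.L` for a rigidified
  fibrewise-`Pic⁰` family `ℒ` on `A_{B′}` and `q` is surjective l.f.t., then `P` satisfies clause (a) over `B`;
* §4 by-product in ★ `RigidifiedLineBundle.comapAlong` currency:
  `RigidifiedLineBundle.FibrewisePicZero.of_comapAlong_of_surjective` — `ℒ` is fibrewise in `Pic⁰` as soon as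
  `(1_A × w)^* ℒ` is, for `w : T₁ → T₂` surjective l.f.t. (converse of ★ `comapAlong_fibrewisePicZero`; compare ★
  `FibrewisePicZero.of_denseRange`, which needs only dense image but also the closedness of the `Pic⁰` locus).

Use (cell `hodgecm-mathlib`, HECKE-LINK brick H2 file (ii), two-step descent of the Poincaré sheaf to a quotient
`A/K`): the descended sheaf `𝒫_B` on `(A/K) ×_S (Â/K′)` is DEFINED by `(1 × ψ̂)^* 𝒫_B ≅ 𝒩₁ = (π × 1)^* 𝒫`, a
rigidified fibrewise-`Pic⁰` family on `(A/K)_{Â}`, and `ψ̂ : Â → Â/K′` is finite surjective — so clause (a) of the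
would-be dual pair `((Â/K′), 𝒫_B)` is `forall_isHomogeneous_fibreSlice_of_rigidified_of_surjective`, independently
of how `𝒫_B` is constructed.  HC_CM is proved only modulo the 7 printed citations until rung 0 closes; nothing here
is about HC.

## References
* [MumfordAV1970] D. Mumford, *Abelian Varieties* (1970), §8 ((iv) ⇔ (i)); §13 (p. 125).
* [MilneAV2008] J. S. Milne, *Abelian Varieties* (2008), I §8 (pp. 36–37).
* [GortzWedhorn2020] U. Görtz, T. Wedhorn, *Algebraic Geometry I*, 2nd ed. (2020), Cor. 3.36 (p. 83), Prop. 4.8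
  (p. 98), Section (4.7) (pp. 107–108).
-/

noncomputable section

universe u

open CategoryTheory CategoryTheory.Limits AlgebraicGeometry MonoidalCategory CartesianMonoidalCategory

namespace Literature.AlgebraicGeometry.AbelianSchemes

namespace AbelianSchemeOver

open Literature.AlgebraicGeometry.Motives Literature.AlgebraicGeometry.AbelianVarieties
  Literature.AlgebraicGeometry.Modules

variable {S : Scheme.{u}} (A : AbelianSchemeOver S)

/-! ### §1 Bookkeeping: `fibreCongrIso` against the second projection and against the fibre slices -/

section FibreCongr

variable {Ω : Type u} [Field Ω] {s₁ s₂ : Spec (.of Ω) ⟶ S}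

/-- The transport ★ `fibreCongrIso` along an equality `s₁ = s₂` of base points commutes with the projections
`A_{sᵢ} → Spec Ω`. [cite: GortzWedhorn2020, Section (4.7) (pp. 107–108)] -/
@[reassoc]
theorem fibreCongrIso_hom_toSchemeHom_snd (h : s₁ = s₂) :
    AbelianVariety.Hom.toSchemeHom (A.fibreCongrIso h).hom ≫ pullback.snd A.X.hom s₂ = pullback.snd A.X.hom s₁ := by
  subst h
  simp only [fibreCongrIso, eqToIso_refl, Iso.refl_hom]
  exact Category.id_comp _

end FibreCongr

section Slice

variable (B' B : AbelianSchemeOver S) (q : B'.X ⟶ B.X) {Ω : Type u} [Field Ω]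

/-- The base point of `t ≫ q` is the base point of `t`. [cite: MilneAV2008, I §8 (pp. 36–37)] -/
theorem comp_left_comp_hom (t : Spec (.of Ω) ⟶ B'.X.left) : t ≫ B'.X.hom = (t ≫ q.left) ≫ B.X.hom := by
  rw [Category.assoc, Over.w q]

/-- **The slice square**: transporting along `A_{t ≫ π′} = A_{(t ≫ q) ≫ π}` and then slicing `A ×_S B` at `t ≫ q`
is slicing `A ×_S B′` at `t` followed by `1_A × q` (both are `(pr_A, pr_Ω ≫ t ≫ q)`).
[cite: MilneAV2008, I §8 (pp. 36–37)] [cite: MumfordAV1970, §13 (p. 125)] -/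
theorem toSchemeHom_fibreCongrIso_hom_comp_fibreSlice (t : Spec (.of Ω) ⟶ B'.X.left) :
    AbelianVariety.Hom.toSchemeHom (A.fibreCongrIso (comp_left_comp_hom B' B q t)).hom ≫
        A.fibreSlice B (t ≫ q.left) = A.fibreSlice B' t ≫ (A.X ◁ q).left := by
  have h := comp_left_comp_hom B' B q t
  -- the right-hand side has the projections `pr_A` and `pr_Ω ≫ t ≫ q`
  have r₀ : (A.fibreSlice B' t ≫ (A.X ◁ q).left) ≫ pullback.fst A.X.hom B.X.hom =
      pullback.fst A.X.hom (t ≫ B'.X.hom) :=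
    (Category.assoc _ _ _).trans
      ((congrArg (fun x => A.fibreSlice B' t ≫ x) (Over.whiskerLeft_left_fst (R := A.X) q)).trans
        (A.fibreSlice_fst B' t))
  have r₁ : (A.fibreSlice B' t ≫ (A.X ◁ q).left) ≫ pullback.snd A.X.hom B.X.hom =
      pullback.snd A.X.hom (t ≫ B'.X.hom) ≫ t ≫ q.left :=
    (Category.assoc _ _ _).trans
      ((congrArg (fun x => A.fibreSlice B' t ≫ x) (Over.whiskerLeft_left_snd (R := A.X) q)).trans
        ((Category.assoc _ _ _).symm.trans
          ((congrArg (fun x => x ≫ q.left) (A.fibreSlice_snd B' t)).trans (Category.assoc _ _ _))))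
  apply pullback.hom_ext
  · exact (Category.assoc _ _ _).trans
      ((congrArg (fun x => AbelianVariety.Hom.toSchemeHom (A.fibreCongrIso h).hom ≫ x)
          (A.fibreSlice_fst B (t ≫ q.left))).trans
        ((A.fibreCongrIso_hom_toSchemeHom_fst h).trans r₀.symm))
  · exact (Category.assoc _ _ _).trans
      ((congrArg (fun x => AbelianVariety.Hom.toSchemeHom (A.fibreCongrIso h).hom ≫ x)
          (A.fibreSlice_snd B (t ≫ q.left))).trans
        ((Category.assoc _ _ _).symm.trans
          ((congrArg (fun x => x ≫ t ≫ q.left) (A.fibreCongrIso_hom_toSchemeHom_snd h)).trans r₁.symm)))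

/-! ### §2 Clause (a) along `1_A × q`: one point, and all points for `q` surjective -/

/-- **The slice of `(1_A × q)^* P` at `t` is homogeneous iff the slice of `P` at `t ≫ q` is** (transport of
translation invariance along the isomorphism of abelian varieties `A_{t ≫ π′} ≅ A_{(t ≫ q) ≫ π}`, ★
`isHomogeneous_pullback_iff_of_iso`, and the slice square). [cite: MumfordAV1970, §8 ((iv) ⇔ (i))]
[cite: MilneAV2008, I §8 (pp. 36–37)] -/
theorem isHomogeneous_fibreSlice_whiskerLeft_iff (P : (A.prodLeft B).Modules) (t : Spec (.of Ω) ⟶ B'.X.left) :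
    IsHomogeneous (A.fibre (t ≫ B'.X.hom)).toAbelianVariety
        ((Scheme.Modules.pullback (A.fibreSlice B' t)).obj ((Scheme.Modules.pullback (A.X ◁ q).left).obj P)) ↔
      IsHomogeneous (A.fibre ((t ≫ q.left) ≫ B.X.hom)).toAbelianVariety
        ((Scheme.Modules.pullback (A.fibreSlice B (t ≫ q.left))).obj P) := by
  rw [← isHomogeneous_pullback_iff_of_iso (A.fibreCongrIso (comp_left_comp_hom B' B q t))
    ((Scheme.Modules.pullback (A.fibreSlice B (t ≫ q.left))).obj P)]
  refine isHomogeneous_iff_of_iso _ ?_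
  exact ((Scheme.Modules.pullbackComp _ _).app P) ≪≫
    (Scheme.Modules.pullbackCongr (A.toSchemeHom_fibreCongrIso_hom_comp_fibreSlice B' B q t).symm).app P ≪≫
    ((Scheme.Modules.pullbackComp _ _).app P).symm

/-- **Clause (a) descends along a surjection of parameter schemes.**  If `(1_A × q)^* P ≅ N` for a module `N` on
`A ×_S B′` whose slices at all geometric points of `B′` are translation invariant, and `q : B′ → B` is surjective
and locally of finite type, then the slices of `P` at all geometric points of `B` are translation invariant — every
geometric point of `B` lifts to `B′` with the same algebraically closed field (★ `Morphisms.exists_comp_eq_of_surjective`).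
The conclusion is the text of the field `fibrewisePicZero` of ★ `AbelianSchemeOver.DualPair` at `(A, B, P)`.
[cite: MumfordAV1970, §8 ((iv) ⇔ (i))] [cite: MilneAV2008, I §8 (pp. 36–37)]
[cite: GortzWedhorn2020, Cor. 3.36 (p. 83) and Prop. 4.8 (p. 98)] -/
theorem forall_isHomogeneous_fibreSlice_of_surjective [Surjective q.left] [LocallyOfFiniteType q.left]
    (P : (A.prodLeft B).Modules) (N : (A.prodLeft B').Modules)
    (e : Nonempty ((Scheme.Modules.pullback (A.X ◁ q).left).obj P ≅ N))
    (hN : ∀ (Ω : Type u) [Field Ω] [IsAlgClosed Ω] (t : Spec (.of Ω) ⟶ B'.X.left),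
      IsHomogeneous (A.fibre (t ≫ B'.X.hom)).toAbelianVariety ((Scheme.Modules.pullback (A.fibreSlice B' t)).obj N))
    (Ω : Type u) [Field Ω] [IsAlgClosed Ω] (b : Spec (.of Ω) ⟶ B.X.left) :
    IsHomogeneous (A.fibre (b ≫ B.X.hom)).toAbelianVariety ((Scheme.Modules.pullback (A.fibreSlice B b)).obj P) := by
  obtain ⟨t, rfl⟩ := Morphisms.exists_comp_eq_of_surjective q.left b
  obtain ⟨e⟩ := e
  exact (A.isHomogeneous_fibreSlice_whiskerLeft_iff B' B q P t).1
    ((isHomogeneous_iff_of_iso _ ((Scheme.Modules.pullback (A.fibreSlice B' t)).mapIso e)).2 (hN Ω t))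

end Slice

/-! ### §3 The bridge to `RigidifiedLineBundle.FibrewisePicZero` and the export for rigidified families -/

section FibreBaseChangeSquare

variable (B' : AbelianSchemeOver S) {Ω : Type u} [Field Ω]

/-- The comparison `(A_{B′})_t ≅ A_{t ≫ π′}` (★ `fibreBaseChangeIso`) followed by the slice of `A ×_S B′` at `t`
is the first projection `(A_{B′})_t → A_{B′}` (both are `(pr_A, pr_Ω ≫ t)`; the square of ★
`DualPair.selfBundle_fibrewisePicZero`, for any parameter scheme). [cite: MilneAV2008, I §8 (pp. 36–37)] -/
theorem toSchemeHom_fibreBaseChangeIso_hom_comp_fibreSlice (t : Spec (.of Ω) ⟶ B'.X.left) :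
    AbelianVariety.Hom.toSchemeHom (A.fibreBaseChangeIso B'.X.hom t).hom ≫ A.fibreSlice B' t =
      pullback.fst (A.baseChange B'.X.hom).X.hom t := by
  have hcond : pullback.fst (A.baseChange B'.X.hom).X.hom t ≫ pullback.snd A.X.hom B'.X.hom =
      pullback.snd (A.baseChange B'.X.hom).X.hom t ≫ t := pullback.condition
  apply pullback.hom_ext
  · exact (Category.assoc _ _ _).trans
      ((congrArg (fun x => AbelianVariety.Hom.toSchemeHom (A.fibreBaseChangeIso B'.X.hom t).hom ≫ x)
          (A.fibreSlice_fst B' t)).trans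
        (A.fibreBaseChangeIso_hom_toSchemeHom_fst B'.X.hom t))
  · exact (Category.assoc _ _ _).trans
      ((congrArg (fun x => AbelianVariety.Hom.toSchemeHom (A.fibreBaseChangeIso B'.X.hom t).hom ≫ x)
          (A.fibreSlice_snd B' t)).trans
        ((Category.assoc _ _ _).symm.trans
          ((congrArg (fun x => x ≫ t) (A.fibreBaseChangeIso_hom_toSchemeHom_snd B'.X.hom t)).trans hcond.symm)))

end FibreBaseChangeSquare

namespace RigidifiedLineBundle

variable {A} (B' : AbelianSchemeOver S) (ℒ : A.RigidifiedLineBundle B'.X.hom) {Ω : Type u} [Field Ω]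

/-- **Bridge**: for a rigidified line bundle `ℒ` on `A_{B′} = A ×_S B′`, the slice of `ℒ.L` at a geometric point
`t` of `B′` (★ `fibreSlice`, the currency of ★ `DualPair.fibrewisePicZero`) is homogeneous iff the fibre module
`ℒ_t` (★ `fibreModule`, the currency of ★ `RigidifiedLineBundle.FibrewisePicZero`) is — transport along
`(A_{B′})_t ≅ A_{t ≫ π′}`. [cite: MumfordAV1970, §8 ((iv) ⇔ (i))] [cite: MilneAV2008, I §8 (pp. 36–37)] -/
theorem isHomogeneous_fibreSlice_iff (t : Spec (.of Ω) ⟶ B'.X.left) :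
    IsHomogeneous (A.fibre (t ≫ B'.X.hom)).toAbelianVariety ((Scheme.Modules.pullback (A.fibreSlice B' t)).obj ℒ.L) ↔
      IsHomogeneous ((A.baseChange B'.X.hom).fibre t).toAbelianVariety (ℒ.fibreModule t) := by
  rw [← isHomogeneous_pullback_iff_of_iso (A.fibreBaseChangeIso B'.X.hom t)
    ((Scheme.Modules.pullback (A.fibreSlice B' t)).obj ℒ.L)]
  refine isHomogeneous_iff_of_iso _ ?_
  exact ((Scheme.Modules.pullbackComp _ _).app ℒ.L) ≪≫
    (Scheme.Modules.pullbackCongr (A.toSchemeHom_fibreBaseChangeIso_hom_comp_fibreSlice B' t)).app ℒ.L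

/-- `ℒ` is fibrewise in `Pic⁰` iff all its slices (in ★ `fibreSlice` currency) are homogeneous.
[cite: MumfordAV1970, §8 ((iv) ⇔ (i))] [cite: MilneAV2008, I §8 (pp. 36–37)] -/
theorem fibrewisePicZero_iff_forall_isHomogeneous_fibreSlice :
    ℒ.FibrewisePicZero ↔ ∀ (Ω : Type u) [Field Ω] [IsAlgClosed Ω] (t : Spec (.of Ω) ⟶ B'.X.left),
      IsHomogeneous (A.fibre (t ≫ B'.X.hom)).toAbelianVariety
        ((Scheme.Modules.pullback (A.fibreSlice B' t)).obj ℒ.L) :=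
  ⟨fun h Ω _ _ t => (isHomogeneous_fibreSlice_iff B' ℒ t).2 (h Ω t),
    fun h Ω _ _ t => (isHomogeneous_fibreSlice_iff B' ℒ t).1 (h Ω t)⟩

/-- **Export (clause (a) of the descended sheaf).**  Let `ℒ` be a rigidified line bundle on `A_{B′}`, fibrewise
in `Pic⁰`, let `q : B′ → B` be a surjective `S`-morphism locally of finite type, and let `P` be a module on
`A ×_S B` with `(1_A × q)^* P ≅ ℒ.L`.  Then `P` satisfies clause (a) of ★ `DualPair` over `B`: for every geometric
point `b` of `B` the slice `P|_{A_s × {b}}` is translation invariant.  (In the two-step descent of the Poincaré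
sheaf to a quotient `A/K`: `P = 𝒫_B` on `(A/K) × (Â/K′)`, `ℒ.L = 𝒩₁ = (π × 1)^*𝒫`, `q = ψ̂`.)
[cite: MumfordAV1970, §8 ((iv) ⇔ (i)); §13 (p. 125)] [cite: MilneAV2008, I §8 (pp. 36–37)] -/
theorem forall_isHomogeneous_fibreSlice_of_rigidified_of_surjective (B : AbelianSchemeOver S) (q : B'.X ⟶ B.X)
    [Surjective q.left] [LocallyOfFiniteType q.left] (P : (A.prodLeft B).Modules) (hℒ : ℒ.FibrewisePicZero)
    (e : Nonempty ((Scheme.Modules.pullback (A.X ◁ q).left).obj P ≅ ℒ.L))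
    (Ω : Type u) [Field Ω] [IsAlgClosed Ω] (b : Spec (.of Ω) ⟶ B.X.left) :
    IsHomogeneous (A.fibre (b ≫ B.X.hom)).toAbelianVariety ((Scheme.Modules.pullback (A.fibreSlice B b)).obj P) :=
  A.forall_isHomogeneous_fibreSlice_of_surjective B' B q P ℒ.L e
    ((fibrewisePicZero_iff_forall_isHomogeneous_fibreSlice B' ℒ).1 hℒ) Ω b

/-! ### §4 By-product: `FibrewisePicZero` descends along a surjection of test schemes (`comapAlong` currency) -/

variable {T₁ T₂ : Scheme.{u}} {f₁ : T₁ ⟶ S} {f₂ : T₂ ⟶ S}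

/-- **`ℒ` is fibrewise in `Pic⁰` as soon as `(1_A × w)^* ℒ` is, for `w : T₁ → T₂` surjective and locally of finite
type** (every geometric point of `T₂` lifts to `T₁` with the same field; ★ `isHomogeneous_fibre_comapAlong_iff`).
Converse of ★ `comapAlong_fibrewisePicZero`. [cite: MumfordAV1970, §8 ((iv) ⇔ (i))] [cite: MilneAV2008, I §8 (pp. 36–37)]
[cite: GortzWedhorn2020, Cor. 3.36 (p. 83) and Prop. 4.8 (p. 98)] -/
theorem FibrewisePicZero.of_comapAlong_of_surjective (ℒ : A.RigidifiedLineBundle f₂) (w : T₁ ⟶ T₂)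
    (hw : w ≫ f₂ = f₁) [Surjective w] [LocallyOfFiniteType w] (h : (ℒ.comapAlong w hw).FibrewisePicZero) :
    ℒ.FibrewisePicZero := by
  intro Ω _ _ t
  obtain ⟨t₁, rfl⟩ := Morphisms.exists_comp_eq_of_surjective w t
  exact (ℒ.isHomogeneous_fibre_comapAlong_iff w hw Ω t₁).1 (h Ω t₁)

/-- `iff` form: along a surjective l.f.t. `w`, `(1_A × w)^* ℒ` is fibrewise in `Pic⁰` iff `ℒ` is.
[cite: MumfordAV1970, §8 ((iv) ⇔ (i))] [cite: MilneAV2008, I §8 (pp. 36–37)] -/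
theorem fibrewisePicZero_comapAlong_iff_of_surjective (ℒ : A.RigidifiedLineBundle f₂) (w : T₁ ⟶ T₂)
    (hw : w ≫ f₂ = f₁) [Surjective w] [LocallyOfFiniteType w] :
    (ℒ.comapAlong w hw).FibrewisePicZero ↔ ℒ.FibrewisePicZero :=
  ⟨FibrewisePicZero.of_comapAlong_of_surjective ℒ w hw, fun h => comapAlong_fibrewisePicZero h w hw⟩

end RigidifiedLineBundle

end AbelianSchemeOver

end Literature.AlgebraicGeometry.AbelianSchemes

end
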